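import Mathlib
import Literature.Analysis.OperatorTheory.Enflo2023.Basic
import Literature.Analysis.OperatorTheory.Enflo2023.Vy
import Literature.Analysis.OperatorTheory.Enflo2023.Type2LargeL
import Literature.Analysis.OperatorTheory.Enflo2023.Type2Sensitivity
import HarnessLib

/-!
# Enflo 2023, v2 p.22: (47) as printed fails already with `‖s_n‖ ≤ 2` (referee divergence D19)

Source under adjudication: Per H. Enflo, *On the invariant subspace problem in Hilbert spaces*, arXiv:2305.15442 (v1
2023, v2 2024), bib key `Enflo2023` — a CLAIMED proof of the invariant subspace problem for operators on a separable
Hilbert space.  This file is part of the kernel-tight typing of the manuscript by the b2b-enflo repair cell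
(formaliser 2, Part B: (28)–(47), the limiting argument and the final deduction).  It records what FOLLOWS (proved
implications from the manuscript's displayed hypotheses) and, where a step does not follow, the typed inference
together with its refutation.  NOTHING here asserts that the manuscript's main theorem holds; no declaration concludes
the invariant subspace problem for an arbitrary operator.  Value (BLOCK-2b): theorems / refutations of typed
inferences about a text — not progress on the problem.

EnfloISP — Part B (formaliser 2), addendum to `Type2Sensitivity.lean` (STEPS row B30, referee divergence D19).
`Type2Sensitivity.printed_eq47_fails` refutes (47) as printed — "Now, if `M(L₀) = ∞` then, for some `n`,
`‖ℓ(T)(y₀' − L₀ s_n) − x₀‖ ≤ 0.3` may require an arbitrarily large `‖ℓ(T)‖₂`.  So, for moving `y₀ + L₀ s_n` by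
minimal `ℓ(T)`'s between the distances `0.3 + δ` and `0.3` to `x₀`, may require arbitrarily small `(εθ)`'s" (v2
p.22), with `M(L)` quantified over ALL `n` as printed on pp.20–21 — by a one-index witness whose rogue vector has
norm `‖s'_0‖ = 17/4`.  The text (p.20: "`y'_n = y₀' + s_n`, `‖s_n‖ ≤ D`") leaves `D` free, so that witness lies in
the text's setting; but the data which the type-2 pipeline of this record actually delivers to p.22
(`Type2.eq20_of_type2`, `Type2.eq47_of_type2`: `s_n = y'_n − y'_∞` for unit vectors `y'_n ⇀ y'_∞`) carry
`‖s_n‖ ≤ 2`, `‖y‖ ≤ 1`, `y ≠ 0` and the angle condition `Re⟨u₀, y⟩ ≥ 1/100`.  The referee (REFEREE.md §14, D19) asked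
whether the refutation survives inside that smaller world.  It does, with the paper-structured witness recorded here
(all kernel-checked, zero sorry):

* data: `y := (12/13) x₀` (`‖y‖ = 12/13 ≤ 1`, `Re⟨x₀, y⟩ = 12/13 ≥ 1/100`, so the angle condition holds with
  `u₀ := x₀`), `s'_0 := −(25/13) x₀` (norm `25/13 ≤ 2`), `s'_n := (5/13) e_n` for `n ≥ 1` (norm `5/13`), where `e_n`
  are unit vectors orthogonal to `x₀` (e.g. an orthonormal sequence, weakly null); `T` any strict contraction with
  `‖T‖ ≤ 1/10` (the text has `‖T‖ = 10⁻²⁰`);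
* the PRINTED threshold is exactly `L₀ = 12/25` (`ex2_threshold`: bounded moves exist at every index for
  `0 < L < 12/25` — the move `(13/12)·1` at the good indices, distance `5L/12 ≤ 1/5`, and a multiple of the identity at
  the rogue index; at `L = 12/25` the rogue data vector `y + L₀ s'_0` is `0`, so nothing is feasible there and
  `M(L₀) = ∞`);
* yet every minimal move of `y + L₀ s'_n`, at every index and every radius `r ∈ [0.3, 0.4]`, has `(εθ) ≥ 1/8`
  (`ex2_etheta_ge`: the move `(81/100)·1` is feasible already at `r = 0.3`, distance² `227149/2640625 < 0.09`, so a
  minimal move has `‖a‖ ≤ 81/100`, `‖V a‖² ≤ (3744/4225)(100/99)(81/100)² < 0.5873`, and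
  `(εθ) ≥ (1 − r² − ‖V a‖²)/2 ≥ (1 − 0.16 − 0.5873)/2 > 1/8`);
* hence the conclusion of (47) ("arbitrarily small `(εθ)`'s between the distances `0.3 + δ` and `0.3`") fails for
  `c = 1/8` and every `δ ≤ 1/10` (`printed_eq47_fails_D2`), while all the norm / angle constraints of the pipeline hold.

So D19 is not a loophole: the misstatement located in `Type2Sensitivity.lean` (the `n`-quantifier of `M(L)`) is
independent of the size of `D`; the repair (eventual quantifier, `MovesBoundedEv`, `Type2.eq47`) is unchanged.  The
companion file `Type2ShiftModel.lean` places the same data under a concrete operator of type 2 (a scaled backward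
shift), where in addition (20) and the weak nullity of `s_n` hold, i.e. every hypothesis and every data conjunct of
`eq47_of_type2` is met.
Dictionary: paper `⟨u, v⟩` (linear in `u`) = Mathlib `⟪v, u⟫_ℂ`; `(εθ)` of a move `y' = V a` at `x₀` =
`Re⟪x₀ − y', y'⟫_ℂ` (`MinimalVector.lean`, (6)); "`‖ℓ‖₂`" = the `ℓ²` norm of the coefficient sequence (`Vy.lean`);
`Good(L)` as printed = `Type2.MovesBounded` (`Type2LargeL.lean`).
STATUS: (47) as printed REFUTED inside the pipeline's `D = 2` constraints (zero sorry); verdict on the manuscript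
unchanged (the type-2 branch dies downstream at the room claim p.20 / (27) p.13).
-/

open scoped InnerProductSpace
open Filter Topology RCLike

namespace Literature.Analysis.OperatorTheory.Enflo2023

namespace Type2

variable {H : Type*} [NormedAddCommGroup H] [InnerProductSpace ℂ H]

/-! ### Small vector identities for real multiples of a unit vector and an orthogonal unit vector -/

omit [InnerProductSpace ℂ H] in
/-- `‖(c : ℂ) • v‖ = |c|` for a unit vector `v` and real `c`. [folklore] -/
lemma norm_real_smul_unit [NormedSpace ℂ H] {v : H} (hv : ‖v‖ = 1) (c : ℝ) :
    ‖((c : ℝ) : ℂ) • v‖ = |c| := by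
  rw [norm_smul, Complex.norm_real, Real.norm_eq_abs, hv, mul_one]

omit [InnerProductSpace ℂ H] in
/-- `c • (a • x₀ + b • v) = (c a) • x₀ + (c b) • v` for real scalars. [folklore] -/
lemma real_smul_combo [NormedSpace ℂ H] (x₀ v : H) (c a b : ℝ) :
    ((c : ℝ) : ℂ) • ((((a : ℝ) : ℂ)) • x₀ + (((b : ℝ) : ℂ)) • v) =
      (((c * a : ℝ)) : ℂ) • x₀ + (((c * b : ℝ)) : ℂ) • v := by
  push_cast
  rw [smul_add, smul_smul, smul_smul]

omit [InnerProductSpace ℂ H] in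
/-- `x₀ − (a • x₀ + b • v) = (1 − a) • x₀ + (−b) • v` for real scalars. [folklore] -/
lemma sub_real_combo [NormedSpace ℂ H] (x₀ v : H) (a b : ℝ) :
    x₀ - ((((a : ℝ) : ℂ)) • x₀ + (((b : ℝ) : ℂ)) • v) =
      (((1 - a : ℝ)) : ℂ) • x₀ + (((-b : ℝ)) : ℂ) • v := by
  push_cast
  rw [sub_smul, one_smul, neg_smul]
  abel

omit [InnerProductSpace ℂ H] in
/-- `(a • x₀ + b • v) − x₀ = (a − 1) • x₀ + b • v` for real scalars. [folklore] -/
lemma real_combo_sub [NormedSpace ℂ H] (x₀ v : H) (a b : ℝ) :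
    ((((a : ℝ) : ℂ)) • x₀ + (((b : ℝ) : ℂ)) • v) - x₀ =
      (((a - 1 : ℝ)) : ℂ) • x₀ + (((b : ℝ)) : ℂ) • v := by
  push_cast
  rw [sub_smul, one_smul]
  abel

/-! ### The `D = 2` data: `y = (12/13) x₀`, `s'_0 = −(25/13) x₀`, `s'_n = (5/13) e_n` -/

/-- The `D = 2` example's data vector `y := (12/13) x₀` (counterexample data for (47) as printed, with the
pipeline's `‖y‖ ≤ 1`). [cite: Enflo2023, v2 p.22, (47)] -/
noncomputable def exY2 (x₀ : H) : H := ((12 / 13 : ℝ) : ℂ) • x₀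

/-- The `D = 2` example's sequence: rogue `s'_0 := −(25/13) x₀` (so that `y + (12/25) s'_0 = 0`) and
`s'_n := (5/13) e_n` for `n ≥ 1`; every term has norm `≤ 2` when `x₀`, `e_n` are unit vectors (counterexample data
for (47) as printed). [cite: Enflo2023, v2 p.22, (47)] -/
noncomputable def exS2 (x₀ : H) (e : ℕ → H) : ℕ → H :=
  fun n => if n = 0 then ((-(25 / 13) : ℝ) : ℂ) • x₀ else ((5 / 13 : ℝ) : ℂ) • e n

/-- `s'_0 = −(25/13) x₀`. [folklore] -/
lemma exS2_zero (x₀ : H) (e : ℕ → H) : exS2 x₀ e 0 = ((-(25 / 13) : ℝ) : ℂ) • x₀ := by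
  simp [exS2]

/-- `s'_n = (5/13) e_n` for `n ≠ 0`. [folklore] -/
lemma exS2_of_ne_zero (x₀ : H) (e : ℕ → H) {n : ℕ} (hn : n ≠ 0) :
    exS2 x₀ e n = ((5 / 13 : ℝ) : ℂ) • e n := by
  simp [exS2, hn]

/-- `‖y‖ = 12/13`. [folklore] -/
lemma norm_exY2 {x₀ : H} (hx₀ : ‖x₀‖ = 1) : ‖exY2 x₀‖ = 12 / 13 := by
  rw [exY2, norm_real_smul_unit hx₀]
  norm_num

/-- `y ≠ 0`. [folklore] -/
lemma exY2_ne_zero {x₀ : H} (hx₀ : ‖x₀‖ = 1) : exY2 x₀ ≠ 0 := by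
  intro h
  have h' := norm_exY2 hx₀
  rw [h, norm_zero] at h'
  norm_num at h'

/-- `‖y‖ ≤ 1` (the pipeline's normalisation of the weak limit `y'_∞`). [folklore] -/
lemma norm_exY2_le_one {x₀ : H} (hx₀ : ‖x₀‖ = 1) : ‖exY2 x₀‖ ≤ 1 := by
  rw [norm_exY2 hx₀]
  norm_num

/-- `Re⟨x₀, y⟩ = 12/13` — so the angle condition `Re⟨u₀, y⟩ ≥ ‖y‖/100` of the type-2 data holds with `u₀ := x₀`.
[folklore] -/
lemma re_inner_exY2 {x₀ : H} (hx₀ : ‖x₀‖ = 1) : re ⟪x₀, exY2 x₀⟫_ℂ = 12 / 13 := by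
  rw [exY2, inner_smul_right, inner_self_eq_norm_sq_to_K, hx₀, re_ofReal_mul']
  simp

/-- `Re⟨x₀, y⟩ ≥ 1/100`. [folklore] -/
lemma re_inner_exY2_ge {x₀ : H} (hx₀ : ‖x₀‖ = 1) : (1 / 100 : ℝ) ≤ re ⟪x₀, exY2 x₀⟫_ℂ := by
  rw [re_inner_exY2 hx₀]
  norm_num

/-- `‖s'_0‖ = 25/13`. [folklore] -/
lemma norm_exS2_zero {x₀ : H} (hx₀ : ‖x₀‖ = 1) (e : ℕ → H) :
    ‖exS2 x₀ e 0‖ = 25 / 13 := by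
  rw [exS2_zero, norm_real_smul_unit hx₀]
  norm_num

/-- `‖s'_n‖ = 5/13` for `n ≠ 0` and unit `e_n`. [folklore] -/
lemma norm_exS2_of_ne_zero (x₀ : H) {e : ℕ → H} {n : ℕ} (he : ‖e n‖ = 1) (hn : n ≠ 0) :
    ‖exS2 x₀ e n‖ = 5 / 13 := by
  rw [exS2_of_ne_zero x₀ e hn, norm_real_smul_unit he]
  norm_num

/-- **`‖s'_n‖ ≤ 2` for every `n`** — the example meets the pipeline's bound `D = 2`. [folklore] -/
lemma norm_exS2_le_two {x₀ : H} (hx₀ : ‖x₀‖ = 1) {e : ℕ → H} (he1 : ∀ n, ‖e n‖ = 1)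
    (n : ℕ) : ‖exS2 x₀ e n‖ ≤ 2 := by
  rcases eq_or_ne n 0 with rfl | hn
  · rw [norm_exS2_zero hx₀]
    norm_num
  · rw [norm_exS2_of_ne_zero x₀ (he1 n) hn]
    norm_num

/-- In the example `y + (12/25) s'_0 = 0` (the rogue data vector vanishes at `L₀ = 12/25`). [folklore] -/
lemma exY2_add_rogue_zero (x₀ : H) (e : ℕ → H) :
    exY2 x₀ + ((12 / 25 : ℝ) : ℂ) • exS2 x₀ e 0 = 0 := by
  rw [exS2_zero, exY2, smul_smul, ← add_smul]
  have h : ((12 / 13 : ℝ) : ℂ) + ((12 / 25 : ℝ) : ℂ) * ((-(25 / 13) : ℝ) : ℂ) = 0 := by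
    push_cast
    ring
  rw [h, zero_smul]

/-- The good data vectors: `y + L s'_n = (12/13) x₀ + (5L/13) e_n` for `n ≠ 0`. [folklore] -/
lemma exY2_add_smul_exS2 (x₀ : H) (e : ℕ → H) (L : ℝ) {n : ℕ} (hn : n ≠ 0) :
    exY2 x₀ + (L : ℂ) • exS2 x₀ e n = ((12 / 13 : ℝ) : ℂ) • x₀ + ((L * (5 / 13) : ℝ) : ℂ) • e n := by
  rw [exS2_of_ne_zero x₀ e hn, exY2, smul_smul]
  push_cast
  rfl

/-! ### The printed threshold of the example is `L₀ = 12/25` -/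

/-- **Example, part 1: `Good(L)` for `0 < L < 12/25`** (printed, all-`n` version).  At the rogue index the data
vector is `((12 − 25L)/13) x₀ ≠ 0` and a multiple of the identity lands on `x₀`; at `n ≥ 1` the move `(13/12)·1`
gives `x₀ + (5L/12) e_n`, at distance `5L/12 ≤ 1/5` from `x₀`. [cite: Enflo2023, v2 p.20] -/
theorem ex2_movesBounded [CompleteSpace H] (T : H →L[ℂ] H) (hT : ‖T‖ < 1) (x₀ : H)
    {e : ℕ → H} (he1 : ∀ n, ‖e n‖ = 1) {L : ℝ} (hL0 : 0 < L) (hL : L < 12 / 25) :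
    MovesBounded T hT x₀ (exY2 x₀) (exS2 x₀ e) L := by
  have h12 : 0 < (12 - 25 * L) / 13 := by
    have : 0 < 12 - 25 * L := by linarith
    positivity
  set t : ℝ := 1 / ((12 - 25 * L) / 13) with ht
  have ht0 : 0 < t := by rw [ht]; exact div_pos one_pos h12
  refine ⟨max (13 / 12) t, fun n => ?_⟩
  rcases Nat.eq_zero_or_pos n with rfl | hn
  · -- the rogue index: a multiple of the identity lands exactly on `x₀`
    refine ⟨((t : ℝ) : ℂ) • lp.single 2 0 (1 : ℂ), ?_, ?_⟩
    · rw [norm_smul, Complex.norm_real, Real.norm_of_nonneg ht0.le, lp.norm_single (by norm_num), norm_one,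
        mul_one]
      exact le_max_right _ _
    · have hw : exY2 x₀ + (L : ℂ) • exS2 x₀ e 0 = ((((12 - 25 * L) / 13 : ℝ)) : ℂ) • x₀ := by
        rw [exS2_zero, exY2, smul_smul, ← add_smul]
        congr 1
        push_cast
        ring
      have hts : ((t : ℝ) : ℂ) * ((((12 - 25 * L) / 13 : ℝ)) : ℂ) = 1 := by
        rw [← Complex.ofReal_mul, ht, one_div_mul_cancel h12.ne', Complex.ofReal_one]
      rw [map_smul, hw, Vy.V_single, pow_zero, one_apply_eq_self, smul_smul, hts, one_smul, sub_self,
        norm_zero]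
      norm_num
  · -- the other indices: the move `(13/12)·1`
    refine ⟨((13 / 12 : ℝ) : ℂ) • lp.single 2 0 (1 : ℂ), ?_, ?_⟩
    · rw [norm_smul, Complex.norm_real, Real.norm_of_nonneg (by norm_num), lp.norm_single (by norm_num),
        norm_one, mul_one]
      exact le_max_left _ _
    · rw [map_smul, Vy.V_single, pow_zero, one_apply_eq_self, exY2_add_smul_exS2 x₀ e L hn.ne',
        real_smul_combo, real_combo_sub]
      have h1 : ((13 / 12 * (12 / 13) - 1 : ℝ) : ℂ) • x₀ = 0 := by
        have : (13 / 12 * (12 / 13) - 1 : ℝ) = 0 := by norm_num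
        rw [this, Complex.ofReal_zero, zero_smul]
      rw [h1, zero_add, norm_real_smul_unit (he1 n), abs_of_pos (by positivity)]
      linarith

/-- **Example, part 2: `¬Good(12/25)`** (printed version): at the rogue index the data vector is `0`, so no move
reaches the `0.3`-ball around the unit vector `x₀` — `M(L₀) = ∞`. [cite: Enflo2023, v2 p.20] -/
theorem ex2_not_movesBounded [CompleteSpace H] (T : H →L[ℂ] H) (hT : ‖T‖ < 1) {x₀ : H} (hx₀ : ‖x₀‖ = 1)
    (e : ℕ → H) : ¬ MovesBounded T hT x₀ (exY2 x₀) (exS2 x₀ e) (12 / 25) := by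
  rintro ⟨M, hM⟩
  obtain ⟨a, -, ha⟩ := hM 0
  have hV0 : Vy.V T hT (exY2 x₀ + ((12 / 25 : ℝ) : ℂ) • exS2 x₀ e 0) a = 0 := by
    rw [exY2_add_rogue_zero, Vy.V_apply]
    simp
  rw [hV0, zero_sub, norm_neg, hx₀] at ha
  norm_num at ha

/-- **Example, part 3: the printed threshold is exactly `L₀ = 12/25`** — the clauses "`Good(L)` for `0 < L < L₀`"
and "`¬Good(L)` for `L ≥ L₀` arbitrarily close to `L₀`" (the form produced by `type2_threshold_or_NIS`) hold for
`L₀ = 12/25` and for no other value. [cite: Enflo2023, v2 pp.20–21] -/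
theorem ex2_threshold [CompleteSpace H] (T : H →L[ℂ] H) (hT : ‖T‖ < 1) {x₀ : H} (hx₀ : ‖x₀‖ = 1)
    {e : ℕ → H} (he1 : ∀ n, ‖e n‖ = 1) :
    ((∀ L, 0 < L → L < 12 / 25 → MovesBounded T hT x₀ (exY2 x₀) (exS2 x₀ e) L) ∧
      ∀ δ > 0, ∃ L, 12 / 25 ≤ L ∧ L < 12 / 25 + δ ∧ 0 < L ∧ ¬ MovesBounded T hT x₀ (exY2 x₀) (exS2 x₀ e) L) ∧
    ∀ L₀ : ℝ, (∀ L, 0 < L → L < L₀ → MovesBounded T hT x₀ (exY2 x₀) (exS2 x₀ e) L) →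
      (∀ δ > 0, ∃ L, L₀ ≤ L ∧ L < L₀ + δ ∧ 0 < L ∧ ¬ MovesBounded T hT x₀ (exY2 x₀) (exS2 x₀ e) L) →
      L₀ = 12 / 25 := by
  refine ⟨⟨fun L hL0 hL => ex2_movesBounded T hT x₀ he1 hL0 hL, fun δ hδ =>
    ⟨12 / 25, le_rfl, by linarith, by norm_num, ex2_not_movesBounded T hT hx₀ e⟩⟩, fun L₀ hbelow habove => ?_⟩
  rcases lt_trichotomy L₀ (12 / 25) with hlt | heq | hgt
  · obtain ⟨L, hL₀L, hLlt, hL0, hnot⟩ := habove (12 / 25 - L₀) (by linarith)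
    exact absurd (ex2_movesBounded T hT x₀ he1 hL0 (by linarith)) hnot
  · exact heq
  · exact absurd (hbelow (12 / 25) (by norm_num) hgt) (ex2_not_movesBounded T hT hx₀ e)

/-! ### No small `(εθ)` at the threshold -/

/-- **Example, part 4: no small `(εθ)` at `L₀ = 12/25`** — at ANY index and ANY radius `r ∈ [0.3, 0.4]`, every
minimal move `a` of `y + L₀ s'_n` into the `r`-ball at `x₀` has `(εθ) = Re⟨x₀ − V a, V a⟩ ≥ 1/8`.  (Index `0`:
nothing is feasible.  Index `n ≥ 1`: the move `(81/100)·1` is feasible — distance² `227149/2640625 ≤ 9/100` — so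
`‖a‖ ≤ 81/100` and `‖V a‖² ≤ ‖y + L₀ s'_n‖²(1 − ‖T‖²)^{-1}(81/100)² ≤ (3744/4225)(100/99)(6561/10000) < 5873/10000`,
whence `(εθ) ≥ (1 − r² − ‖V a‖²)/2 ≥ (1 − 16/100 − 5873/10000)/2 ≥ 1/8`.)  This requires `‖T‖` small — as in the
text, where `‖T‖ = 10⁻²⁰`. [cite: Enflo2023, v2 p.22, (47)] -/
theorem ex2_etheta_ge [CompleteSpace H] (T : H →L[ℂ] H) (hT : ‖T‖ < 1) (hT' : ‖T‖ ≤ 1 / 10) {x₀ : H}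
    (hx₀ : ‖x₀‖ = 1) {e : ℕ → H} (he1 : ∀ n, ‖e n‖ = 1) (he0 : ∀ n, ⟪x₀, e n⟫_ℂ = 0)
    (n : ℕ) {r : ℝ} (hr : 3 / 10 ≤ r) (hr' : r ≤ 2 / 5) {a : Vy.ℓ2}
    (ha : IsMinimal (Vy.V T hT (exY2 x₀ + ((12 / 25 : ℝ) : ℂ) • exS2 x₀ e n)) x₀ r a) :
    1 / 8 ≤ re ⟪x₀ - Vy.V T hT (exY2 x₀ + ((12 / 25 : ℝ) : ℂ) • exS2 x₀ e n) a,
      Vy.V T hT (exY2 x₀ + ((12 / 25 : ℝ) : ℂ) • exS2 x₀ e n) a⟫_ℂ := by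
  set w : H := exY2 x₀ + ((12 / 25 : ℝ) : ℂ) • exS2 x₀ e n with hw_def
  have hfeas : ‖x₀ - Vy.V T hT w a‖ ≤ r := ha.norm_sub_le
  rcases Nat.eq_zero_or_pos n with rfl | hn
  · -- rogue index: the data vector is `0`, nothing is feasible at radius `r < 1`
    exfalso
    have hV0 : Vy.V T hT w a = 0 := by
      rw [hw_def, exY2_add_rogue_zero, Vy.V_apply]
      simp
    rw [hV0, sub_zero, hx₀] at hfeas
    linarith
  · have hwn : w = ((12 / 13 : ℝ) : ℂ) • x₀ + ((12 / 25 * (5 / 13) : ℝ) : ℂ) • e n := by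
      rw [hw_def, exY2_add_smul_exS2 x₀ e (12 / 25) hn.ne']
    -- the move `(81/100)·1` is feasible, so `‖a‖ ≤ 81/100`
    have hb : ((81 / 100 : ℝ) : ℂ) • lp.single 2 0 (1 : ℂ) ∈ feasible (Vy.V T hT w) x₀ r := by
      rw [mem_feasible, map_smul, Vy.V_single, pow_zero, one_apply_eq_self]
      have h3 : ‖x₀ - ((81 / 100 : ℝ) : ℂ) • w‖ ^ 2 ≤ r ^ 2 := by
        rw [hwn, real_smul_combo, sub_real_combo, norm_sq_combo hx₀ (he1 n) (he0 n)]
        have h4 : (3 / 10 : ℝ) ^ 2 ≤ r ^ 2 := pow_le_pow_left₀ (by norm_num) hr 2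
        norm_num at h4 ⊢
        linarith
      exact (pow_le_pow_iff_left₀ (norm_nonneg _) (by linarith) two_ne_zero).1 h3
    have ha1 : ‖a‖ ≤ 81 / 100 := by
      have h := ha.norm_le hb
      rwa [norm_smul, Complex.norm_real, Real.norm_of_nonneg (by norm_num : (0 : ℝ) ≤ 81 / 100),
        lp.norm_single (by norm_num), norm_one, mul_one] at h
    -- `‖V_w a‖² ≤ ‖w‖² (1 − ‖T‖²)^{-1} ‖a‖² ≤ (3744/4225)(100/99)(81/100)²`
    have hw2 : ‖w‖ ^ 2 = 3744 / 4225 := by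
      rw [hwn, norm_sq_combo hx₀ (he1 n) (he0 n)]
      norm_num
    have hκ2 : Real.sqrt (1 / (1 - ‖T‖ ^ 2)) ^ 2 ≤ 100 / 99 := by
      have hT2 : ‖T‖ ^ 2 ≤ (1 / 10) ^ 2 := pow_le_pow_left₀ (norm_nonneg _) hT' 2
      norm_num at hT2
      have h1 : 0 < 1 - ‖T‖ ^ 2 := by linarith
      rw [Real.sq_sqrt (div_pos one_pos h1).le]
      calc 1 / (1 - ‖T‖ ^ 2) ≤ 1 / (99 / 100) := one_div_le_one_div_of_le (by norm_num) (by linarith)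
        _ = 100 / 99 := by norm_num
    have hVa : ‖Vy.V T hT w a‖ ^ 2 ≤ 3744 / 4225 * (100 / 99) * (81 / 100) ^ 2 := by
      have hκ0 : 0 ≤ Real.sqrt (1 / (1 - ‖T‖ ^ 2)) := Real.sqrt_nonneg _
      have h1 : ‖Vy.V T hT w a‖ ≤ ‖w‖ * Real.sqrt (1 / (1 - ‖T‖ ^ 2)) * ‖a‖ :=
        (Vy.V T hT w).le_of_opNorm_le (Vy.norm_V_le T hT w) a
      have h2 : ‖Vy.V T hT w a‖ ≤ ‖w‖ * Real.sqrt (1 / (1 - ‖T‖ ^ 2)) * (81 / 100) :=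
        h1.trans (mul_le_mul_of_nonneg_left ha1 (mul_nonneg (norm_nonneg _) hκ0))
      calc ‖Vy.V T hT w a‖ ^ 2 ≤ (‖w‖ * Real.sqrt (1 / (1 - ‖T‖ ^ 2)) * (81 / 100)) ^ 2 :=
            pow_le_pow_left₀ (norm_nonneg _) h2 2
        _ = ‖w‖ ^ 2 * Real.sqrt (1 / (1 - ‖T‖ ^ 2)) ^ 2 * (81 / 100) ^ 2 := by ring
        _ ≤ 3744 / 4225 * (100 / 99) * (81 / 100) ^ 2 := by
            rw [hw2]
            have h5 : (0 : ℝ) ≤ 3744 / 4225 := by norm_num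
            have h6 : (0 : ℝ) ≤ (81 / 100) ^ 2 := by positivity
            exact mul_le_mul_of_nonneg_right (mul_le_mul_of_nonneg_left hκ2 h5) h6
    have hVa' : ‖Vy.V T hT w a‖ ^ 2 ≤ 52488 / 89375 := hVa.trans (by norm_num)
    have h := etheta_ge_of_norm_sub_le hx₀ hfeas
    have hr2 : r ^ 2 ≤ 4 / 25 := (pow_le_pow_left₀ (by linarith) hr' 2).trans (by norm_num)
    linarith

/-! ### (47) as printed fails inside the pipeline's `D = 2` constraints -/

/-- **(47) as printed does not follow, already with `‖s_n‖ ≤ 2`, `‖y‖ ≤ 1`, `y ≠ 0`, `Re⟨x₀, y⟩ ≥ 1/100`** (v2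
pp.20–22, STEPS B30, referee divergence D19): with `M(L)` quantified over ALL `n` (`MovesBounded`, the printed
wording), the data `y = (12/13) x₀`, `s'_0 = −(25/13) x₀`, `s'_n = (5/13) e_n` (`e_n` unit, `⊥ x₀`) satisfy every
norm / angle constraint the type-2 pipeline puts on its data, the hypotheses of (47) hold — threshold exactly
`L₀ = 12/25`, `Good(L)` below, `¬Good` at and just above `L₀`, `M(L₀) = ∞` — and the conclusion of (47) fails: for
`c = 1/8` and every `δ ≤ 1/10` there is NO index `n`, NO radius `r ∈ [0.3, 0.3 + δ]` and NO minimal move of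
`y + L₀ s'_n` into the `r`-ball at `x₀` with `(εθ) < c`; indeed `(εθ) ≥ 1/8` for every minimal move at every index and
every radius in `[0.3, 0.4]`.  The failing sentence is "Now, if `M(L₀) = ∞` then, for some `n`, … may require an
arbitrarily large `‖ℓ(T)‖₂`.  So … may require arbitrarily small `(εθ)`'s" (v2 p.22).  The repair is unchanged:
the eventual-in-`n` threshold (`MovesBoundedEv`, `Type2.eq47`). [cite: Enflo2023, v2 p.22, (47); refuted as printed] -/
theorem printed_eq47_fails_D2 [CompleteSpace H] (T : H →L[ℂ] H) (hT : ‖T‖ < 1) (hT' : ‖T‖ ≤ 1 / 10)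
    {x₀ : H} (hx₀ : ‖x₀‖ = 1) {e : ℕ → H} (he1 : ∀ n, ‖e n‖ = 1) (he0 : ∀ n, ⟪x₀, e n⟫_ℂ = 0) :
    (exY2 x₀ ≠ 0 ∧ ‖exY2 x₀‖ ≤ 1 ∧ (1 / 100 : ℝ) ≤ re ⟪x₀, exY2 x₀⟫_ℂ ∧ ∀ n, ‖exS2 x₀ e n‖ ≤ 2) ∧
    ((∀ L, 0 < L → L < 12 / 25 → MovesBounded T hT x₀ (exY2 x₀) (exS2 x₀ e) L) ∧
      ∀ δ > 0, ∃ L, 12 / 25 ≤ L ∧ L < 12 / 25 + δ ∧ 0 < L ∧ ¬ MovesBounded T hT x₀ (exY2 x₀) (exS2 x₀ e) L) ∧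
    (∀ L₀ : ℝ, (∀ L, 0 < L → L < L₀ → MovesBounded T hT x₀ (exY2 x₀) (exS2 x₀ e) L) →
      (∀ δ > 0, ∃ L, L₀ ≤ L ∧ L < L₀ + δ ∧ 0 < L ∧ ¬ MovesBounded T hT x₀ (exY2 x₀) (exS2 x₀ e) L) →
      L₀ = 12 / 25) ∧
    ¬ MovesBounded T hT x₀ (exY2 x₀) (exS2 x₀ e) (12 / 25) ∧
    ¬ (∀ c > 0, ∀ δ > 0, ∀ N : ℕ, ∃ n, N ≤ n ∧ ∃ r : ℝ, 3 / 10 ≤ r ∧ r ≤ 3 / 10 + δ ∧ ∃ a : Vy.ℓ2,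
        IsMinimal (Vy.V T hT (exY2 x₀ + ((12 / 25 : ℝ) : ℂ) • exS2 x₀ e n)) x₀ r a ∧
        0 ≤ re ⟪x₀ - Vy.V T hT (exY2 x₀ + ((12 / 25 : ℝ) : ℂ) • exS2 x₀ e n) a,
          Vy.V T hT (exY2 x₀ + ((12 / 25 : ℝ) : ℂ) • exS2 x₀ e n) a⟫_ℂ ∧
        re ⟪x₀ - Vy.V T hT (exY2 x₀ + ((12 / 25 : ℝ) : ℂ) • exS2 x₀ e n) a,
          Vy.V T hT (exY2 x₀ + ((12 / 25 : ℝ) : ℂ) • exS2 x₀ e n) a⟫_ℂ < c) ∧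
    ∀ (n : ℕ) (r : ℝ) (a : Vy.ℓ2), 3 / 10 ≤ r → r ≤ 2 / 5 →
      IsMinimal (Vy.V T hT (exY2 x₀ + ((12 / 25 : ℝ) : ℂ) • exS2 x₀ e n)) x₀ r a →
      1 / 8 ≤ re ⟪x₀ - Vy.V T hT (exY2 x₀ + ((12 / 25 : ℝ) : ℂ) • exS2 x₀ e n) a,
        Vy.V T hT (exY2 x₀ + ((12 / 25 : ℝ) : ℂ) • exS2 x₀ e n) a⟫_ℂ := by
  obtain ⟨hthr, huniq⟩ := ex2_threshold T hT hx₀ he1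
  refine ⟨⟨exY2_ne_zero hx₀, norm_exY2_le_one hx₀, re_inner_exY2_ge hx₀, norm_exS2_le_two hx₀ he1⟩, hthr, huniq,
    ex2_not_movesBounded T hT hx₀ e, fun h47 => ?_,
    fun n r a hr hr' ha => ex2_etheta_ge T hT hT' hx₀ he1 he0 n hr hr' ha⟩
  obtain ⟨n, -, r, hr, hr', a, ha, -, hlt⟩ := h47 (1 / 8) (by norm_num) (1 / 10) (by norm_num) 0
  have hge := ex2_etheta_ge T hT hT' hx₀ he1 he0 n hr (by linarith) ha
  linarith

end Type2

end Literature.Analysis.OperatorTheory.Enflo2023
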